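import Summits.RiemannHypothesis.RiemannHypothesis.Theorems.SoloInformedRigidityPrimeSide
import Summits.RiemannHypothesis.RiemannHypothesis.Theorems.SoloInformedRigidityArch
import Summits.RiemannHypothesis.RiemannHypothesis.Theorems.SoloInformedRigidityPolar
import Summits.RiemannHypothesis.RiemannHypothesis.Theorems.SoloInformedCellCountStep
import Literature.NumberTheory.LFunctions.ZetaZerosProofs
import HarnessLib

/-!
# Pair-correlation rigidity under RH: the window second-moment inequality (T72h, soloist)

Sorry-free; the one number-theoretic input is `RiemannHypothesis` (as a hypothesis).  This file
assembles Lemma 2k.E of the soloist's `paper/sharpest.md` §2k (xi) up to the choice of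
parameters.  Fix a Weil test `Φ` with `supp Φ ⊆ [-a, a]`, a bandwidth `b ≥ 1`, an integer `N`
with `2ab ≤ log (N+1)`, a floor `μ ≤ |Φ̂(1/2 + iu)|²` on `|u| ≤ 2`, and a window `[A, A + J/b)`
(`A ≥ 1`) cut into `J` cells of length `1/b`.  With the probe `f_{b,t} = Φ_b e^{-it·}`:

* (L) on cell `j`, `Re Q(f_{b,t}) ≥ b μ (N(A + (j+1)/b) - N(A + j/b))` (RH; T72d);
* (U) `Re Q(f_{b,t}) ≤ P₀ + A₀ + |Re P(f ⋆ f̃)|` with `P₀ = 2 (e^{ab/2} ‖Φ'‖₁ / A)²` (polar, T72g'),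
  `A₀ = ‖Φ‖₂² (log (3 + A + J/b) + 12 + log π) + (1/2π) ∫ |Φ̂|² log (1 + |v|)` (arch, T72g), and
  `∫_A^{A+J/b} (Re P)² ≤ 4 (J/b + 2N²) ‖Φ‖₂⁴ Σ_{n ≤ N} Λ(n)²/n` (prime mean square, T72f);
* (C) cells (T72c').

**Theorem** (`rigidity_window_moment`, RH):
`b μ² (N(A + J/b) - N(A))² ≤ #{j < J : cell j holds a zero} ·
  (3 (J/b) (P₀² + A₀²) + 12 (J/b + 2N²) ‖Φ‖₂⁴ Σ_{n ≤ N} Λ(n)²/n)`.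

With `b ≍ log R`, `N = ⌊e^{2ab}⌋ ≤ R^{1/2}`, `J/b ≍ R` at height `h` (so `N(A+J/b) - N(A) ≍ R log h`
by Riemann–von Mangoldt and the right factor is `O(R log² h)`), this gives `≫ R log R` occupied
cells, i.e. `≫ R log R` ordinates pairwise `≥ 1/log R` apart in every window of length `R` —
the anticlustering law (AC*) that turns the conditional size law E3 into a consequence of RH alone
(`SoloInformedAnticlusteringLaw`), to be completed in T72i.
-/

noncomputable section

open Real Complex MeasureTheory Set Filter Finset Literature.NumberTheory.LFunctions

namespace Summit.RiemannHypothesis.RiemannHypothesis.Theorems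

/-- Support of the dilate `Φ_b`: `supp Φ ⊆ [-a, a]` gives `supp Φ_b ⊆ [-ab, ab]`. -/
theorem tsupport_dilate_subset (Φ : ℝ → ℂ) {b : ℝ} (hb : 0 < b) {a : ℝ}
    (h : tsupport Φ ⊆ Icc (-a) a) :
    tsupport (weilDilate (b⁻¹ - 1) Φ) ⊆ Icc (-(a * b)) (a * b) := by
  have h1 := tsupport_weilDilate_subset Φ (neg_one_lt_inv_sub_one hb) h
  have h2 : (1 : ℝ) + (b⁻¹ - 1) = b⁻¹ := by ring
  rwa [h2, div_inv_eq_mul] at h1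

/-- `Re Q(f) = Re (polar) - Re (prime) + Re (arch)` of `f ⋆ f̃`. -/
theorem re_weilQuadratic_eq (f : ℝ → ℂ) :
    (weilQuadratic f).re = (weilPolarTerm (weilConv f (weilReflect f))).re -
      (weilPrimeTerm (weilConv f (weilReflect f))).re +
      (weilArchTerm (weilConv f (weilReflect f))).re := by
  rw [weilQuadratic, weilFunctional, Complex.add_re, Complex.sub_re]

/-- **(U), pointwise**: on `A ≤ t ≤ A + L` (`A ≥ 1`, `b ≥ 1`),
`Re Q(f_{b,t}) ≤ P₀ + A₀ + |Re P(f ⋆ f̃)|`. -/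
theorem re_weilQuadratic_probe_le {Φ : ℝ → ℂ} (hΦ : IsWeilTest Φ) {a : ℝ} (ha0 : 0 ≤ a)
    (ha : tsupport Φ ⊆ Icc (-a) a) {b : ℝ} (hb : 1 ≤ b) {A L t : ℝ} (hA : 1 ≤ A)
    (ht1 : A ≤ t) (ht2 : t ≤ A + L) :
    (weilQuadratic fun x ↦ weilDilate (b⁻¹ - 1) Φ x * cexp (((-t) * x : ℝ) * I)).re ≤
      2 * (Real.exp (a * b / 2) * (∫ x : ℝ, ‖deriv Φ x‖) / A) ^ 2 +
      ((∫ x : ℝ, ‖Φ x‖ ^ 2) * (Real.log (3 + (A + L)) + 12 + Real.log π) +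
        1 / (2 * π) * ∫ v : ℝ, ‖weilMellin Φ (1 / 2 + v * I)‖ ^ 2 * Real.log (1 + |v|)) +
      |(weilPrimeTerm (weilConv (fun x ↦ weilDilate (b⁻¹ - 1) Φ x * cexp (((-t) * x : ℝ) * I))
        (weilReflect fun x ↦ weilDilate (b⁻¹ - 1) Φ x * cexp (((-t) * x : ℝ) * I)))).re| := by
  have ht0 : 0 < t := by linarith
  have hpol := abs_re_weilPolarTerm_probe_le hΦ ha0 ha hb ht0.ne'
  have harch := abs_re_weilArchTerm_probe_le hΦ hb t
  have hD : 0 ≤ ∫ x : ℝ, ‖deriv Φ x‖ := integral_nonneg fun _ ↦ norm_nonneg _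
  have hE : 0 ≤ ∫ x : ℝ, ‖Φ x‖ ^ 2 := integral_nonneg fun _ ↦ by positivity
  have hx0 : 0 ≤ Real.exp (a * b / 2) * (∫ x : ℝ, ‖deriv Φ x‖) / |t| := by positivity
  have hxy : Real.exp (a * b / 2) * (∫ x : ℝ, ‖deriv Φ x‖) / |t| ≤
      Real.exp (a * b / 2) * (∫ x : ℝ, ‖deriv Φ x‖) / A :=
    div_le_div_of_nonneg_left (by positivity) (by linarith) (by rw [abs_of_pos ht0]; exact ht1)
  have h1 := hpol.trans (mul_le_mul_of_nonneg_left (pow_le_pow_left₀ hx0 hxy 2) two_pos.le)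
  have hlog : Real.log (3 + |t|) ≤ Real.log (3 + (A + L)) := by
    rw [abs_of_pos ht0]
    exact Real.log_le_log (by positivity) (by linarith)
  have h2 : |(weilArchTerm (weilConv (fun x ↦ weilDilate (b⁻¹ - 1) Φ x *
      cexp (((-t) * x : ℝ) * I)) (weilReflect fun x ↦ weilDilate (b⁻¹ - 1) Φ x *
      cexp (((-t) * x : ℝ) * I)))).re| ≤
      (∫ x : ℝ, ‖Φ x‖ ^ 2) * (Real.log (3 + (A + L)) + 12 + Real.log π) +
        1 / (2 * π) * ∫ v : ℝ, ‖weilMellin Φ (1 / 2 + v * I)‖ ^ 2 * Real.log (1 + |v|) :=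
    harch.trans (by linarith [mul_le_mul_of_nonneg_left hlog hE])
  rw [re_weilQuadratic_eq]
  obtain ⟨hp1, hp2⟩ := abs_le.1 h1
  obtain ⟨ha1, ha2⟩ := abs_le.1 h2
  linarith [neg_abs_le (weilPrimeTerm (weilConv (fun x ↦ weilDilate (b⁻¹ - 1) Φ x *
    cexp (((-t) * x : ℝ) * I)) (weilReflect fun x ↦ weilDilate (b⁻¹ - 1) Φ x *
    cexp (((-t) * x : ℝ) * I)))).re]

/-- **Lemma 2k.E, second-moment form (RH).**  See the module docstring. -/
theorem rigidity_window_moment (hRH : _root_.RiemannHypothesis) {Φ : ℝ → ℂ} (hΦ : IsWeilTest Φ)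
    {a : ℝ} (ha0 : 0 ≤ a) (ha : tsupport Φ ⊆ Icc (-a) a) {b : ℝ} (hb : 1 ≤ b) {μ : ℝ}
    (hμ0 : 0 ≤ μ) (hμ : ∀ u : ℝ, |u| ≤ 2 → μ ≤ ‖weilMellin Φ (1 / 2 + u * I)‖ ^ 2) {N : ℕ}
    (hN : 2 * (a * b) ≤ Real.log ((N : ℝ) + 1)) {A : ℝ} (hA : 1 ≤ A) (J : ℕ) :
    b * μ ^ 2 * ((zetaZeroCount (A + J / b) : ℝ) - zetaZeroCount A) ^ 2 ≤
      ((range J).filter (fun j : ℕ ↦ (zetaZeroCount (A + (j : ℝ) / b) : ℝ) <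
          zetaZeroCount (A + ((j : ℝ) + 1) / b))).card *
        (3 * (J / b) * ((2 * (Real.exp (a * b / 2) * (∫ x : ℝ, ‖deriv Φ x‖) / A) ^ 2) ^ 2 +
            ((∫ x : ℝ, ‖Φ x‖ ^ 2) * (Real.log (3 + (A + J / b)) + 12 + Real.log π) +
              1 / (2 * π) * ∫ v : ℝ, ‖weilMellin Φ (1 / 2 + v * I)‖ ^ 2 *
                Real.log (1 + |v|)) ^ 2) +
          12 * (J / b + 2 * (N : ℝ) ^ 2) * ((∫ x : ℝ, ‖Φ x‖ ^ 2) ^ 2 *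
            ∑ n ∈ Finset.Icc 1 N, ArithmeticFunction.vonMangoldt n ^ 2 / (n : ℝ))) := by
  have hb0 : 0 < b := by linarith
  have hη := neg_one_lt_inv_sub_one hb0
  have hg : IsWeilTest (weilDilate (b⁻¹ - 1) Φ) := hΦ.weilDilate hη
  have hB := tsupport_dilate_subset Φ hb0 ha
  have hEb : ∫ x : ℝ, ‖weilDilate (b⁻¹ - 1) Φ x‖ ^ 2 = ∫ x : ℝ, ‖Φ x‖ ^ 2 :=
    integral_norm_sq_weilDilate Φ hη
  -- the three constants and the Dirichlet polynomial
  obtain ⟨P₀, hP₀⟩ : ∃ P₀ : ℝ, P₀ = 2 * (Real.exp (a * b / 2) * (∫ x : ℝ, ‖deriv Φ x‖) / A) ^ 2 :=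
    ⟨_, rfl⟩
  obtain ⟨A₀, hA₀⟩ : ∃ A₀ : ℝ, A₀ = (∫ x : ℝ, ‖Φ x‖ ^ 2) * (Real.log (3 + (A + J / b)) + 12 +
      Real.log π) + 1 / (2 * π) * ∫ v : ℝ, ‖weilMellin Φ (1 / 2 + v * I)‖ ^ 2 *
      Real.log (1 + |v|) := ⟨_, rfl⟩
  obtain ⟨M, hM⟩ : ∃ M : ℝ, M = (∫ x : ℝ, ‖Φ x‖ ^ 2) ^ 2 *
      ∑ n ∈ Finset.Icc 1 N, ArithmeticFunction.vonMangoldt n ^ 2 / (n : ℝ) := ⟨_, rfl⟩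
  obtain ⟨D, hD⟩ : ∃ D : ℝ → ℂ, D = fun t : ℝ ↦ ∑ n ∈ Finset.Icc 1 N,
      ((ArithmeticFunction.vonMangoldt n : ℝ) : ℂ) / (Real.sqrt n : ℂ) *
        weilConv (weilDilate (b⁻¹ - 1) Φ) (weilReflect (weilDilate (b⁻¹ - 1) Φ)) (Real.log n) *
        cexp (((-(Real.log n * t) : ℝ) : ℂ) * I) := ⟨_, rfl⟩
  have hP : ∀ t : ℝ, (weilPrimeTerm (weilConv (fun x ↦ weilDilate (b⁻¹ - 1) Φ x *
      cexp (((-t) * x : ℝ) * I)) (weilReflect fun x ↦ weilDilate (b⁻¹ - 1) Φ x *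
      cexp (((-t) * x : ℝ) * I)))).re = 2 * (D t).re := fun t ↦ by
    rw [re_weilPrimeTerm_modulate hg hB hN t, hD]
  have hDc : Continuous D := by
    rw [hD]
    exact continuous_finsetSum _ fun n _ ↦ continuous_const.mul (Complex.continuous_exp.comp
      ((continuous_ofReal.comp ((continuous_const.mul continuous_id')).neg).mul
        continuous_const))
  -- the majorant `Y`
  obtain ⟨Y, hY⟩ : ∃ Y : ℝ → ℝ, Y = fun t ↦ P₀ + A₀ + |2 * (D t).re| := ⟨_, rfl⟩
  have hYc : Continuous Y := by
    rw [hY]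
    exact continuous_const.add ((continuous_const.mul (Complex.continuous_re.comp hDc)).abs)
  rw [← hP₀, ← hA₀, ← hM]
  -- (L) + (U): the cell hypothesis of T72c'
  have hZ : ∀ j < J, ∀ t ∈ Ico (A + (j : ℝ) / b) (A + ((j : ℝ) + 1) / b),
      b * μ * ((zetaZeroCount (A + ((j : ℝ) + 1) / b) : ℝ) - zetaZeroCount (A + (j : ℝ) / b)) ≤
        Y t := by
    intro j hj t ht
    obtain ⟨ht1, ht2⟩ := ht
    have hjb : (0 : ℝ) ≤ j / b := by positivity
    have hj' : (j : ℝ) + 1 ≤ J := by exact_mod_cast hj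
    have hJb : ((j : ℝ) + 1) / b ≤ J / b := div_le_div_of_nonneg_right hj' hb0.le
    have e : ((j : ℝ) + 1) / b = j / b + 1 / b := by rw [add_div]
    have h1b : 1 / b ≤ 2 / b := div_le_div_of_nonneg_right (by norm_num) hb0.le
    have hL := probe_zetaZeroCount_le_re_weilQuadratic hRH hΦ hb0 hμ (t := t)
      (T₁ := A + (j : ℝ) / b) (T₂ := A + ((j : ℝ) + 1) / b) (by linarith) (by linarith)
      (by linarith) (by linarith)
    have hU := re_weilQuadratic_probe_le hΦ ha0 ha hb hA (L := J / b) (t := t) (by linarith)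
      (by linarith)
    rw [hP t, ← hP₀, ← hA₀] at hU
    rw [hY]
    exact hL.trans hU
  have hint : IntegrableOn (fun t ↦ Y t ^ 2) (Ico A (A + J / b)) :=
    (hYc.pow 2).integrableOn_Icc.mono_set Ico_subset_Icc_self
  have hC := mul_sq_increment_le_card_mul_integral_sq (fun x : ℝ ↦ (zetaZeroCount x : ℝ))
    (fun x y hxy ↦ by dsimp only; exact_mod_cast zetaZeroCount_mono hxy) hb0 hμ0 A J Y hZ hint
  -- the second moment of `Y`
  have hAJ : A ≤ A + J / b := le_add_of_nonneg_right (by positivity)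
  have hprime := intervalIntegral_sq_re_weilPrimeTerm_modulate_le hg hB hN hAJ
  rw [hEb, ← hM, show A + (J : ℝ) / b - A = J / b by ring] at hprime
  have hprime' : ∫ t in A..A + J / b, (2 * (D t).re) ^ 2 ≤ 4 * (J / b + 2 * (N : ℝ) ^ 2) * M := by
    refine le_of_eq_of_le (intervalIntegral.integral_congr fun t _ ↦ ?_) hprime
    simp only [hP t]
  have hmom : ∫ t in Ico A (A + J / b), Y t ^ 2 ≤
      3 * (J / b) * (P₀ ^ 2 + A₀ ^ 2) + 12 * (J / b + 2 * (N : ℝ) ^ 2) * M := by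
    rw [integral_Ico_eq_integral_Ioc, ← intervalIntegral.integral_of_le hAJ]
    have h3 : ∫ t in A..A + J / b, Y t ^ 2 ≤
        ∫ t in A..A + J / b, 3 * (P₀ ^ 2 + A₀ ^ 2) + 3 * (2 * (D t).re) ^ 2 := by
      refine intervalIntegral.integral_mono_on hAJ ((hYc.pow 2).intervalIntegrable _ _)
        ((continuous_const.add (continuous_const.mul ((continuous_const.mul
          (Complex.continuous_re.comp hDc)).pow 2))).intervalIntegrable _ _) fun t _ ↦ ?_
      rw [hY]
      dsimp only
      have hsq : |2 * (D t).re| ^ 2 = (2 * (D t).re) ^ 2 := sq_abs _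
      nlinarith [sq_nonneg (P₀ - A₀), sq_nonneg (P₀ - |2 * (D t).re|),
        sq_nonneg (A₀ - |2 * (D t).re|)]
    refine h3.trans ?_
    have hi1 : IntervalIntegrable (fun _ : ℝ ↦ 3 * (P₀ ^ 2 + A₀ ^ 2)) volume A (A + J / b) :=
      intervalIntegrable_const
    have hi2 : IntervalIntegrable (fun t : ℝ ↦ 3 * (2 * (D t).re) ^ 2) volume A (A + J / b) :=
      ((continuous_const.mul ((continuous_const.mul (Complex.continuous_re.comp hDc)).pow
        2)).intervalIntegrable _ _)
    rw [intervalIntegral.integral_add hi1 hi2, intervalIntegral.integral_const, smul_eq_mul,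
      intervalIntegral.integral_const_mul, show A + (J : ℝ) / b - A = J / b by ring]
    nlinarith [hprime']
  have hcard : (0 : ℝ) ≤ ((range J).filter (fun j : ℕ ↦ (zetaZeroCount (A + (j : ℝ) / b) : ℝ) <
      zetaZeroCount (A + ((j : ℝ) + 1) / b))).card := Nat.cast_nonneg _
  exact hC.trans (mul_le_mul_of_nonneg_left hmom hcard)

end Summit.RiemannHypothesis.RiemannHypothesis.Theorems

end
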